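import Summits.CriticalPhenomena.CardyFormulaZ2.Theorems.CardyBoundaryCoulombGasBoundaryDefectGaussianRStubTransportPathsPart11

/-!
# Stub `stub_transportPaths` of line `rainbow-monomials-in-excursion-kernels` — Part 20:
# marks on edges, the anchor parameter, cyclic gaps and clearances
# (crux `CardyBoundaryCoulombGas.BoundaryDefectGaussianR`, stmt-CriticalPhenomena-14132)

Continuum constants of TRANSPORT attached to the marks of the marked domain `D` and to the
polygon of Part 8 (`tp_marks_anchor`):

* every (flat) mark lies in the OPEN parameter interval of an edge `zm i`;
* an ANCHOR parameter `α ∈ [0, 1)` on a bottom edge `zA` (`a zA = 0`) which is congruent to no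
  mark (the open edge interval is infinite, the marks modulo `1` near it are finitely many);
* `η₀ > 0` with all cyclic gaps between distinct elements of `{marks} ∪ {α}` at least `2 η₀`
  (input of the tube lemma, Part 4, for the separation of a mover from the parked points);
* `dmm > 0` below the mutual distances of the marked points, `dA > 0` below the distances of the
  anchor point `γ α` to the marked points.
All [folklore].
-/

noncomputable section

open Set Filter Metric Topology
open Literature.Probability.RandomPlanarGeometry
open Summit.CriticalPhenomena.CardyFormulaZ2.Cruxes.RectilinearCardy.ExcursionKernelCovariance

namespace Summit.CriticalPhenomena.CardyFormulaZ2.Cruxes.BoundaryDefectGaussianR.RainbowMonomialsInExcursionKernels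

/-- Cyclic gaps: if two reals differ by less than `1` and are distinct modulo the three nearest
integer translates with gap `≥ g ≤ 1`, then they differ by `≥ g` modulo every integer.
[folklore] -/
theorem tp_cyclic_gap {t t' g : ℝ} (hg : g ≤ 1) (hlt : |t - t'| < 1)
    (h : ∀ n : ℤ, -1 ≤ n → n ≤ 1 → g ≤ |t - t' - n|) : ∀ n : ℤ, g ≤ |t - t' - n| := by
  intro n
  by_cases hn : -1 ≤ n ∧ n ≤ 1
  · exact h n hn.1 hn.2
  · rw [not_and_or, not_le, not_le] at hn
    have habs := abs_lt.1 hlt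
    rcases hn with hn | hn
    · have hn2 : (n : ℝ) ≤ -2 := by exact_mod_cast (show n ≤ -2 by omega)
      rw [abs_of_nonneg (by linarith)]; linarith
    · have hn2 : (2 : ℝ) ≤ n := by exact_mod_cast (show 2 ≤ n by omega)
      rw [abs_of_nonpos (by linarith)]; linarith

/-- **Marks on edges, the anchor, cyclic gaps and clearances.** See the module docstring.
[folklore] -/
theorem tp_marks_anchor {k : ℕ} (D : MarkedDomain k) {M : ℕ} {c : ℤ → ℝ} {a : ℤ → ℕ}
    (hM2 : 2 ≤ M) (hcmono : StrictMono c) (hcper : ∀ z, c (z + M) = c z + 1)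
    (hcorner : ∀ z, ¬ (∃ r' : ℝ, 0 < r' ∧ ((∀ w ∈ frontier D.carrier, dist w (D.boundary (c z)) < r' → w.im = (D.boundary (c z)).im) ∨ (∀ w ∈ frontier D.carrier, dist w (D.boundary (c z)) < r' → w.re = (D.boundary (c z)).re))))
    (hash : ∀ (z n : ℤ), a (z + n * M) = a z) {z₀ : ℤ} (hz₀ : a z₀ = 0)
    (hFlat : ∀ i, ∃ r : ℝ, 0 < r ∧ ((∀ z ∈ frontier D.carrier, dist z (D.pt i) < r →
      z.im = (D.pt i).im) ∨ (∀ z ∈ frontier D.carrier, dist z (D.pt i) < r →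
      z.re = (D.pt i).re))) :
    ∃ (zm : Fin k → ℤ) (α : ℝ) (zA : ℤ) (η₀ dmm dA : ℝ),
      (∀ i, D.mark i ∈ Ioo (c (zm i)) (c (zm i + 1))) ∧
      a zA = 0 ∧ α ∈ Ioo (c zA) (c (zA + 1)) ∧ α ∈ Ico (0 : ℝ) 1 ∧ (∀ i, ∀ n : ℤ, α ≠ D.mark i + n) ∧
      0 < η₀ ∧ η₀ ≤ 1 / 4 ∧
      (∀ i i', i ≠ i' → ∀ n : ℤ, 2 * η₀ ≤ |D.mark i - D.mark i' - n|) ∧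
      (∀ i, ∀ n : ℤ, 2 * η₀ ≤ |α - D.mark i - n|) ∧
      0 < dmm ∧ (∀ i i', i ≠ i' → dmm ≤ dist (D.pt i) (D.pt i')) ∧
      0 < dA ∧ (∀ i, dA ≤ dist (D.boundary α) (D.pt i)) := by
  classical
  have hM : 0 < M := by omega
  have hshift := tp_c_shift hcper
  -- marks are not corners, so they lie inside edges
  have hzm : ∀ i, ∃ z : ℤ, D.mark i ∈ Ioo (c z) (c (z + 1)) := by
    intro i
    obtain ⟨z, -, -, n, hmem⟩ := tp_param_cover hM hcper (D.mark i) 0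
    refine ⟨z - n * M, ?_, ?_⟩
    · have e : c (z - n * M) = c z - n := by
        have := hshift z (-n); rw [show z + -n * ↑M = z - n * ↑M by ring] at this
        rw [this]; push_cast; ring
      rw [e]
      rcases hmem.1.eq_or_lt with h | h
      · exfalso
        refine hcorner z ?_
        obtain ⟨r, hr, hfl⟩ := hFlat i
        have hpt : D.pt i = D.boundary (c z) := by
          rw [h]
          have := (D.periodic_boundary.int_mul n) (D.mark i)
          rw [mul_one] at this
          exact this.symm
        rw [hpt] at hfl
        exact ⟨r, hr, hfl⟩
      · linarith
    · have e : c (z - n * M + 1) = c (z + 1) - n := by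
        have := hshift (z + 1) (-n); rw [show z + 1 + -n * ↑M = z - n * ↑M + 1 by ring] at this
        rw [this]; push_cast; ring
      rw [e]; linarith [hmem.2]
  choose zm hzm using hzm
  -- the anchor
  have hz₀lt : c z₀ < c (z₀ + 1) := hcmono (by omega)
  set Fm : Finset ℝ := (Finset.univ ×ˢ Finset.Icc (⌊c z₀⌋ - 1) (⌊c z₀⌋ + 2)).image
    (fun p : Fin k × ℤ => D.mark p.1 + p.2) with hFm
  obtain ⟨α₀, hα₀, hα₀F⟩ := (Ioo_infinite hz₀lt).exists_notMem_finset Fm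
  have hα₀m : ∀ i, ∀ n : ℤ, α₀ ≠ D.mark i + n := by
    intro i n h
    have hmk := D.mark_mem i
    have hc1 : c (z₀ + 1) ≤ c z₀ + 1 := by
      have := hcmono.monotone (show z₀ + 1 ≤ z₀ + M by omega)
      rw [hcper] at this; exact this
    have hn1 : (⌊c z₀⌋ : ℝ) ≤ c z₀ := Int.floor_le _
    have hn2 : c z₀ < ⌊c z₀⌋ + 1 := Int.lt_floor_add_one _
    have hnlo : ⌊c z₀⌋ - 1 ≤ n := by
      by_contra hlt; push Not at hlt
      have : (n : ℝ) ≤ ⌊c z₀⌋ - 2 := by exact_mod_cast (show n ≤ ⌊c z₀⌋ - 2 by omega)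
      linarith [hα₀.1, hmk.2]
    have hnhi : n ≤ ⌊c z₀⌋ + 2 := by
      by_contra hlt; push Not at hlt
      have : (⌊c z₀⌋ : ℝ) + 3 ≤ n := by exact_mod_cast (show ⌊c z₀⌋ + 3 ≤ n by omega)
      linarith [hα₀.2, hmk.1]
    exact hα₀F (Finset.mem_image.2 ⟨(i, n), Finset.mem_product.2 ⟨Finset.mem_univ _,
      Finset.mem_Icc.2 ⟨hnlo, hnhi⟩⟩, h.symm⟩)
  set α := α₀ - ⌊α₀⌋ with hα
  set zA := z₀ - ⌊α₀⌋ * M with hzA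
  have hczA : c zA = c z₀ - ⌊α₀⌋ := by
    have := hshift z₀ (-⌊α₀⌋); rw [show z₀ + -⌊α₀⌋ * ↑M = zA by rw [hzA]; ring] at this
    rw [this]; push_cast; ring
  have hczA1 : c (zA + 1) = c (z₀ + 1) - ⌊α₀⌋ := by
    have := hshift (z₀ + 1) (-⌊α₀⌋)
    rw [show z₀ + 1 + -⌊α₀⌋ * ↑M = zA + 1 by rw [hzA]; ring] at this
    rw [this]; push_cast; ring
  have hαm : ∀ i, ∀ n : ℤ, α ≠ D.mark i + n := by
    intro i n h
    refine hα₀m i (n + ⌊α₀⌋) ?_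
    rw [hα] at h; push_cast; linarith
  -- cyclic gaps
  set G : Finset ℝ := ((Finset.univ ×ˢ Finset.univ ×ˢ Finset.Icc (-1 : ℤ) 1).filter
      (fun p : Fin k × Fin k × ℤ => p.1 ≠ p.2.1)).image
      (fun p : Fin k × Fin k × ℤ => |D.mark p.1 - D.mark p.2.1 - p.2.2|) ∪
    (Finset.univ ×ˢ Finset.Icc (-1 : ℤ) 1).image (fun p : Fin k × ℤ => |α - D.mark p.1 - p.2|)
    with hG
  have hGpos : ∀ g ∈ G, 0 < g := by
    intro g hg
    rw [hG, Finset.mem_union, Finset.mem_image, Finset.mem_image] at hg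
    rcases hg with ⟨⟨i, i', n⟩, hp, rfl⟩ | ⟨⟨i, n⟩, -, rfl⟩
    · have hne : i ≠ i' := (Finset.mem_filter.1 hp).2
      refine abs_pos.2 (sub_ne_zero.2 fun h => ?_)
      have h1 := D.mark_mem i
      have h2 := D.mark_mem i'
      have hn0 : n = 0 := by
        have : |(n : ℝ)| < 1 := by rw [← h, abs_lt]; constructor <;> linarith [h1.1, h1.2, h2.1, h2.2]
        have : |n| < 1 := by exact_mod_cast this
        exact Int.abs_lt_one_iff.1 this
      rw [hn0, Int.cast_zero, sub_eq_zero] at h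
      exact hne (D.strictMono_mark.injective h)
    · exact abs_pos.2 (sub_ne_zero.2 fun h => hαm i n (by linarith))
  obtain ⟨η₀, hη₀, hη₀4, hη₀G⟩ : ∃ η₀ : ℝ, 0 < η₀ ∧ η₀ ≤ 1 / 4 ∧ ∀ g ∈ G, 2 * η₀ ≤ g := by
    by_cases hne : G.Nonempty
    · obtain ⟨g₀, hg₀, hmin⟩ := G.exists_min_image id hne
      refine ⟨min (1 / 4) (g₀ / 2), lt_min (by norm_num) (half_pos (hGpos g₀ hg₀)), min_le_left _ _,
        fun g hg => ?_⟩
      have h1 := hmin g hg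
      simp only [id] at h1
      linarith [min_le_right (1 / 4 : ℝ) (g₀ / 2)]
    · refine ⟨1 / 4, by norm_num, le_rfl, fun g hg => absurd ⟨g, hg⟩ hne⟩
  have hαIco : α ∈ Ico (0 : ℝ) 1 := ⟨by rw [hα]; linarith [Int.floor_le α₀],
    by rw [hα]; linarith [Int.lt_floor_add_one α₀]⟩
  have hgap1 : ∀ i i', i ≠ i' → ∀ n : ℤ, 2 * η₀ ≤ |D.mark i - D.mark i' - n| := by
    intro i i' hne
    have h1 := D.mark_mem i
    have h2 := D.mark_mem i'
    refine tp_cyclic_gap (by linarith) (by rw [abs_lt]; constructor <;> linarith [h1.1, h1.2, h2.1, h2.2])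
      fun n hn1 hn2 => hη₀G _ ?_
    rw [hG, Finset.mem_union]; left
    exact Finset.mem_image.2 ⟨(i, i', n), Finset.mem_filter.2 ⟨Finset.mem_product.2
      ⟨Finset.mem_univ _, Finset.mem_product.2 ⟨Finset.mem_univ _, Finset.mem_Icc.2 ⟨hn1, hn2⟩⟩⟩,
      hne⟩, rfl⟩
  have hgap2 : ∀ i, ∀ n : ℤ, 2 * η₀ ≤ |α - D.mark i - n| := by
    intro i
    have h1 := D.mark_mem i
    refine tp_cyclic_gap (by linarith) (by rw [abs_lt]; constructor <;> linarith [h1.1, h1.2, hαIco.1, hαIco.2])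
      fun n hn1 hn2 => hη₀G _ ?_
    rw [hG, Finset.mem_union]; right
    exact Finset.mem_image.2 ⟨(i, n), Finset.mem_product.2 ⟨Finset.mem_univ _,
      Finset.mem_Icc.2 ⟨hn1, hn2⟩⟩, rfl⟩
  -- clearances
  obtain ⟨dmm, hdmm, hdmm'⟩ : ∃ dmm : ℝ, 0 < dmm ∧ ∀ i i', i ≠ i' → dmm ≤ dist (D.pt i) (D.pt i') := by
    set H : Finset ℝ := ((Finset.univ ×ˢ Finset.univ).filter (fun p : Fin k × Fin k => p.1 ≠ p.2)).image
      (fun p : Fin k × Fin k => dist (D.pt p.1) (D.pt p.2)) with hH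
    by_cases hne : H.Nonempty
    · obtain ⟨d₀, hd₀, hmin⟩ := H.exists_min_image id hne
      refine ⟨d₀, ?_, fun i i' hii' => ?_⟩
      · obtain ⟨⟨i, i'⟩, hp, rfl⟩ := Finset.mem_image.1 hd₀
        exact dist_pos.2 fun h => (Finset.mem_filter.1 hp).2 (D.pt_injective h)
      · have := hmin _ (Finset.mem_image.2 ⟨(i, i'), Finset.mem_filter.2
          ⟨Finset.mem_product.2 ⟨Finset.mem_univ _, Finset.mem_univ _⟩, hii'⟩, rfl⟩)
        simpa using this
    · exact ⟨1, one_pos, fun i i' hii' => absurd ⟨_, Finset.mem_image.2 ⟨(i, i'),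
        Finset.mem_filter.2 ⟨Finset.mem_product.2 ⟨Finset.mem_univ _, Finset.mem_univ _⟩, hii'⟩,
        rfl⟩⟩ hne⟩
  obtain ⟨dA, hdA, hdA'⟩ : ∃ dA : ℝ, 0 < dA ∧ ∀ i, dA ≤ dist (D.boundary α) (D.pt i) := by
    have hne' : ∀ i, D.boundary α ≠ D.pt i := by
      intro i h
      have := D.injOn_boundary hαIco (D.mark_mem i) h
      exact hαm i 0 (by rw [this]; simp)
    set H : Finset ℝ := Finset.univ.image (fun i : Fin k => dist (D.boundary α) (D.pt i)) with hH
    by_cases hne : H.Nonempty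
    · obtain ⟨d₀, hd₀, hmin⟩ := H.exists_min_image id hne
      refine ⟨d₀, ?_, fun i => ?_⟩
      · obtain ⟨i, -, rfl⟩ := Finset.mem_image.1 hd₀
        exact dist_pos.2 (hne' i)
      · have := hmin _ (Finset.mem_image.2 ⟨i, Finset.mem_univ _, rfl⟩)
        simpa using this
    · exact ⟨1, one_pos, fun i => absurd ⟨_, Finset.mem_image.2 ⟨i, Finset.mem_univ _, rfl⟩⟩ hne⟩
  refine ⟨zm, α, zA, η₀, dmm, dA, hzm, ?_, ?_, hαIco, fun i n => hαm i n, hη₀, hη₀4, hgap1, hgap2,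
    hdmm, hdmm', hdA, hdA'⟩
  · rw [hzA, show z₀ - ⌊α₀⌋ * ↑M = z₀ + -⌊α₀⌋ * ↑M by ring, hash]; exact hz₀
  · rw [hczA, hczA1]
    exact ⟨by rw [hα]; linarith [hα₀.1], by rw [hα]; linarith [hα₀.2]⟩

/-- **Registered sub-goal `s7_marksAnchor` of stub `stub_transportPaths`** (marks on edges, the
anchor, cyclic gaps and clearances; one-line form of `tp_marks_anchor`). [folklore] -/
theorem s7_marksAnchor : ∀ (k : ℕ) (D : MarkedDomain k) (M : ℕ) (c : ℤ → ℝ) (a : ℤ → ℕ), (2 ≤ M) → (StrictMono c) → (∀ z, c (z + M) = c z + 1) → (∀ z, ¬ (∃ r' : ℝ, 0 < r' ∧ ((∀ w ∈ frontier D.carrier, dist w (D.boundary (c z)) < r' → w.im = (D.boundary (c z)).im) ∨ (∀ w ∈ frontier D.carrier, dist w (D.boundary (c z)) < r' → w.re = (D.boundary (c z)).re)))) → (∀ (z n : ℤ), a (z + n * M) = a z) → ∀ (z₀ : ℤ), (a z₀ = 0) → (∀ i, ∃ r : ℝ, 0 < r ∧ ((∀ z ∈ frontier D.carrier, dist z (D.pt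 i) < r → z.im = (D.pt i).im) ∨ (∀ z ∈ frontier D.carrier, dist z (D.pt i) < r → z.re = (D.pt i).re))) → ∃ (zm : Fin k → ℤ) (α : ℝ) (zA : ℤ) (η₀ dmm dA : ℝ), (∀ i, D.mark i ∈ Set.Ioo (c (zm i)) (c (zm i + 1))) ∧ a zA = 0 ∧ α ∈ Set.Ioo (c zA) (c (zA + 1)) ∧ α ∈ Set.Ico (0 : ℝ) 1 ∧ (∀ i, ∀ n : ℤ, α ≠ D.mark i + n) ∧ 0 < η₀ ∧ η₀ ≤ 1 / 4 ∧ (∀ i i', i ≠ i' → ∀ n : ℤ, 2 * η₀ ≤ |D.mark i - D.mark i' - n|) ∧ (∀ i, ∀ n : ℤ, 2 * η₀ ≤ |α - D.mark i - n|) ∧ 0 < dmm ∧ (∀ i i', i ≠ i' → dmm ≤ dist (D.pt i) (D.pt i')) ∧ 0 < dA ∧ (∀ i, dA ≤ dist (D.boundary α) (D.pt i)) :=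
  fun _ D _ _ _ hM2 hcmono hcper hcorner hash _ hz₀ hFlat =>
    tp_marks_anchor D hM2 hcmono hcper hcorner hash hz₀ hFlat

end Summit.CriticalPhenomena.CardyFormulaZ2.Cruxes.BoundaryDefectGaussianR.RainbowMonomialsInExcursionKernels

end
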